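import Literature.Combinatorics.Optimization.TracialDesigns
import Literature.Combinatorics.SetFamily.SpreadApproximationWeighted
import HarnessLib

/-!
# Cell pnp-psdrank, route `ChebyshevTracialDesign`: SYNCHRONISATION TOOLS for the dense non-crossing psd cell — the majority lemma,
# homogeneity of heavy sub-weights, and 'full-rank operators have no tight partners'

Dimension-free ingredients of the incidence-rigidity line for the crux `TracialDecayExp20` (stmt-PneNP-19878), brick 59 (prover g11; MEMO-14 §5):
after bricks 51–57 the crux is the dense cell hred_exp; MEMO-14 §5 proposes to control it by the DENSITY of tight pairs between any dense cut weight and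
any homogeneous-dense matching weight (quantitative spectral non-tightness, the cell's (SNT-q), mod Keevash–Lifshitz) combined with the EXACT
orthogonality of ranges on tight pairs. This file lands the three reusable, KL-free steps of that argument:
* §1 **`exists_heavy_label`** (MAJORITY LEMMA) — for a finite label set `L` with two nonnegative weights `a` (cut mass per label) and `b` (matching
  mass per label): if every `G ⊆ L` with `a(G) ≥ ε` carries MORE THAN HALF of `b` (`b(L) < 2·b(G)`), then a SINGLE label carries all but `2ε` of `a`
  (`a(L) < a(i*) + 2ε`). In the synchronisation argument (r = 2: labels = lines; general r: the classes of a subspace cover) the premise is supplied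
  by (SNT-q) + tightness, and the conclusion makes the cut side monochromatic up to junk `2ε`.
* §2 **`isRelHomogeneousW_of_le_of_half`** — a sub-weight `y' ≤ y` carrying at least half of the mass of a `(𝒜, τ)`-homogeneous weight `y` (`τ ≥ 1`)
  is `(𝒜, 2τ)`-homogeneous: restricting the matching side to a HEAVY class keeps Kupavskii–Zakharov homogeneity with a factor 2 (this is why the
  synchronisation argument restricts to heavy classes instead of peeling, which would destroy homogeneity).
* §3 **`tight_partner_eq_zero_of_posDef`** / **`no_active_tight_pair_of_posDef`** — if every cut operator of a family `A` is positive definite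
  (`X_U ⪰ λ_U I`, `λ_U > 0`), then `Y_M = 0` for every `M` tight with some `U ∈ A` (brick 58), so `(tr X/r)|_A` and `tr Y/r` have NO active tight pair;
  with (SNT-q) this makes the full-rank cuts `x`-sparse and the full-rank matchings a `y`-minority (`fullRank_cuts_sparse_of_SNT`, stated against an
  explicit (SNT-q)-shaped hypothesis).
[cite: KupavskiiZakharov2022, §2 (homogeneity)] [cite: BrietDadushPokutta2014, Thm. 6 (§3)] [cite: Rothvoss2017, §2 (PDF p. 6)]
Stature: support/instrument (no defs; §1–§2 pure combinatorics, §3 linear algebra; the (SNT-q) input is a hypothesis). WHAT THIS IS NOT: not the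
r = 2 synchronisation theorem itself, nothing on the dense cell's value, nothing on psd rank, no P-vs-NP content. Supports stmt-PneNP-19878.
-/

set_option linter.dupNamespace false -- `Summit.PneNP.PneNP.…`: summit = sub-problem (D-0017)

noncomputable section

namespace Summit.PneNP.PneNP.Theorems.ChebyshevTracialDesignSynchronisationTools

open Finset Matrix Literature.Barriers.PneNP Literature.Combinatorics.Optimization
open Literature.Combinatorics.SetFamily

/-! ### §1 The majority lemma -/

/-- **MAJORITY LEMMA.** Let `L` be a finite set of labels with weights `a, b` (no sign needed), and `ε > 0`. If every `G ⊆ L` with `ε ≤ a(G)` satisfies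
`b(L) < 2·b(G)` (it carries more than half of `b`), and `2ε ≤ a(L)`, then some single label `i ∈ L` has `a(L) < a(i) + 2ε`.
(Take `G` of minimal cardinality with `a(G) ≥ ε`: removing any `i ∈ G` drops below `ε`; and `a(L ∖ G) < ε`, since otherwise both `G` and `L ∖ G`
would carry more than half of `b`.) [folklore] -/
theorem exists_heavy_label {ι : Type*} [DecidableEq ι] (L : Finset ι) (a b : ι → ℝ) {ε : ℝ} (hε : 0 < ε) (h : ∀ G, G ⊆ L → ε ≤ ∑ i ∈ G, a i → ∑ i ∈ L, b i < 2 * ∑ i ∈ G, b i) (hL : 2 * ε ≤ ∑ i ∈ L, a i) :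
    ∃ i ∈ L, ∑ j ∈ L, a j < a i + 2 * ε := by
  -- the family of `ε`-heavy subsets is nonempty (it contains `L`)
  set S := L.powerset.filter (fun G => ε ≤ ∑ i ∈ G, a i) with hS
  have hLS : L ∈ S := mem_filter.2 ⟨mem_powerset.2 Subset.rfl, by linarith⟩
  obtain ⟨G, hG, hmin⟩ := exists_min_image S Finset.card ⟨L, hLS⟩
  obtain ⟨hGL, hGa⟩ := mem_filter.1 hG
  have hGL' : G ⊆ L := mem_powerset.1 hGL
  -- `G` is nonempty
  have hGne : G.Nonempty := by
    rw [nonempty_iff_ne_empty]; rintro rfl; simp at hGa; linarith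
  obtain ⟨i, hi⟩ := hGne
  refine ⟨i, hGL' hi, ?_⟩
  -- removing `i` drops below `ε`
  have h1 : ∑ j ∈ G.erase i, a j < ε := by
    by_contra hge
    push Not at hge
    have hmem : G.erase i ∈ S := mem_filter.2 ⟨mem_powerset.2 ((erase_subset i G).trans hGL'), hge⟩
    have := hmin _ hmem
    rw [card_erase_of_mem hi] at this
    have : 0 < G.card := card_pos.2 ⟨i, hi⟩
    omega
  -- the complement is light
  have h2 : ∑ j ∈ L \ G, a j < ε := by
    by_contra hge
    push Not at hge
    have hc := h (L \ G) sdiff_subset hge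
    have hg := h G hGL' hGa
    have hsplit : ∑ j ∈ L, b j = ∑ j ∈ G, b j + ∑ j ∈ L \ G, b j := by
      rw [← sum_union disjoint_sdiff, union_sdiff_of_subset hGL']
    rw [hsplit] at hc hg
    linarith
  have hsplitA : ∑ j ∈ L, a j = ∑ j ∈ G, a j + ∑ j ∈ L \ G, a j := by
    rw [← sum_union disjoint_sdiff, union_sdiff_of_subset hGL']
  rw [hsplitA, ← add_sum_erase G a hi]
  linarith

/-! ### §2 Heavy sub-weights of homogeneous weights are homogeneous -/

/-- **A heavy sub-weight of a homogeneous weight is homogeneous (factor 2).** If `y` is `(𝒜, τ)`-homogeneous on `ℱ` (`τ ≥ 1`), `0 ≤ y' ≤ y`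
pointwise and `y(ℱ) ≤ 2·y'(ℱ)`, then `y'` is `(𝒜, 2τ)`-homogeneous on `ℱ`. [cite: KupavskiiZakharov2022, §2 (definition of homogeneity)] -/
theorem isRelHomogeneousW_of_le_of_half {α : Type*} [DecidableEq α] {τ : ℝ} (hτ : 1 ≤ τ) {𝒜 ℱ : Finset (Finset α)}
    {y y' : Finset α → ℝ} (hy : IsRelHomogeneousW τ 𝒜 y ℱ) (h0 : ∀ A, 0 ≤ y' A) (hle : ∀ A, y' A ≤ y A)
    (hhalf : wmass y ℱ ≤ 2 * wmass y' ℱ) : IsRelHomogeneousW (2 * τ) 𝒜 y' ℱ := by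
  intro S
  rcases S.eq_empty_or_nonempty with rfl | hS
  · simp only [supersets_emptyset, card_empty, pow_zero, one_mul]
    exact le_of_eq (mul_comm _ _)
  have hk : 1 ≤ S.card := card_pos.2 hS
  have h1 : wmass y' (supersets ℱ S) ≤ wmass y (supersets ℱ S) := sum_le_sum fun A _ => hle A
  have hA : (0 : ℝ) ≤ (𝒜.card : ℝ) := Nat.cast_nonneg _
  have hAS : (0 : ℝ) ≤ ((supersets 𝒜 S).card : ℝ) := Nat.cast_nonneg _
  have hτk : (0 : ℝ) ≤ τ ^ S.card := pow_nonneg (by linarith) _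
  have h2 : 2 * τ ^ S.card ≤ (2 * τ) ^ S.card := by
    rw [mul_pow]
    exact mul_le_mul_of_nonneg_right (by
      calc (2 : ℝ) = 2 ^ 1 := (pow_one _).symm
        _ ≤ 2 ^ S.card := pow_le_pow_right₀ (by norm_num) hk) hτk
  have hw' : 0 ≤ wmass y' ℱ := wmass_nonneg h0 ℱ
  calc wmass y' (supersets ℱ S) * 𝒜.card ≤ wmass y (supersets ℱ S) * 𝒜.card := mul_le_mul_of_nonneg_right h1 hA
    _ ≤ τ ^ S.card * (supersets 𝒜 S).card * wmass y ℱ := hy S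
    _ ≤ τ ^ S.card * (supersets 𝒜 S).card * (2 * wmass y' ℱ) := mul_le_mul_of_nonneg_left hhalf (mul_nonneg hτk hAS)
    _ = (2 * τ ^ S.card) * (supersets 𝒜 S).card * wmass y' ℱ := by ring
    _ ≤ (2 * τ) ^ S.card * (supersets 𝒜 S).card * wmass y' ℱ :=
        mul_le_mul_of_nonneg_right (mul_le_mul_of_nonneg_right h2 hAS) hw'

/-! ### §3 Positive definite operators have no tight partners -/

variable {n r : ℕ}

/-- **A cut family of positive definite operators kills the matching side on its tight neighbourhood**: if `X_U ⪰ λ_U I` with `λ_U > 0` for all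
`U ∈ A`, then `Y_M = 0` whenever `M` is tight with some `U ∈ A`. [cite: BrietDadushPokutta2014, Thm. 6 (§3)] -/
theorem tight_partner_eq_zero_of_posDef {X : OddSet n → Matrix (Fin r) (Fin r) ℝ} {Y : PMatch n → Matrix (Fin r) (Fin r) ℝ} (hXY : IsPsdRect X Y)
    {A : Finset (OddSet n)} {lam : OddSet n → ℝ} (hpos : ∀ U ∈ A, 0 < lam U)
    (hlam : ∀ U ∈ A, (X U - lam U • (1 : Matrix (Fin r) (Fin r) ℝ)).PosSemidef) {U : OddSet n} (hU : U ∈ A) {M : PMatch n}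
    (hcc : cc U M = 1) : Y M = 0 := by
  -- `X_U = λ_U I + (X_U − λ_U I)` is positive definite, hence invertible (brick 58 `mul_eq_zero_of_tight_of_pos`, inlined)
  have h1 : (lam U • (1 : Matrix (Fin r) (Fin r) ℝ)).PosDef := PosDef.one.smul (hpos U hU)
  have hPD := h1.add_posSemidef (hlam U hU)
  rw [add_sub_cancel] at hPD
  have hdet : IsUnit (X U).det := (isUnit_iff_isUnit_det (X U)).1 hPD.isUnit
  have h := nonsing_inv_mul_cancel_left (X U) (Y M) hdet
  rw [hXY.2.2 U M hcc, Matrix.mul_zero] at h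
  exact h.symm

/-- Hence the normalised traces `x = tr X/r` restricted to `A` and `y = tr Y/r` have **no active tight pair**: `cc(U,M) = 1`, `U ∈ A` ⇒
`x_U · y_M = 0` (indeed `y_M = 0`). [cite: BrietDadushPokutta2014, Thm. 6 (§3)] -/
theorem no_active_tight_pair_of_posDef {X : OddSet n → Matrix (Fin r) (Fin r) ℝ} {Y : PMatch n → Matrix (Fin r) (Fin r) ℝ} (hXY : IsPsdRect X Y)
    {A : Finset (OddSet n)} {lam : OddSet n → ℝ} (hpos : ∀ U ∈ A, 0 < lam U)
    (hlam : ∀ U ∈ A, (X U - lam U • (1 : Matrix (Fin r) (Fin r) ℝ)).PosSemidef) {U : OddSet n} (hU : U ∈ A) {M : PMatch n}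
    (hcc : cc U M = 1) : (Y M).trace = 0 := by
  rw [tight_partner_eq_zero_of_posDef hXY hpos hlam hU hcc, trace_zero]

/-- **Full-rank cuts are sparse, given quantitative non-tightness.** Suppose (SNT-q)-existence holds in the form: every `[0,1]`-weight `x` on the
`t`-cuts of density `≥ ε` and the given matching weight `y` (e.g. `tr Y_M/r`, assumed dense and homogeneous by whoever supplies the hypothesis) have
an ACTIVE TIGHT PAIR (`cc = 1`, `x_U > 0`, `y_M > 0`). Then for a tight-orthogonal psd rectangle `(X, Y)` the family `A` of cuts on which `X_U` is
positive definite has `x`-density `< ε` for `x = (tr X_U/r)·1_A` — since by `no_active_tight_pair_of_posDef` that weight has no active tight pair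
with `y`. [cite: Rothvoss2017, §2 (PDF p. 6)] -/
theorem fullRank_cuts_sparse_of_SNT {t : ℕ} (hr : 0 < r) {ε : ℝ}
    {X : OddSet n → Matrix (Fin r) (Fin r) ℝ} {Y : PMatch n → Matrix (Fin r) (Fin r) ℝ} (hXY : IsPsdRect X Y)
    (hSNT : ∀ x : OddSet n → ℝ, (∀ U, 0 ≤ x U ∧ x U ≤ 1) → (∀ U, U.1.card ≠ t → x U = 0) →
      ε * ((univ.filter fun U : OddSet n => U.1.card = t).card : ℝ) ≤ ∑ U, x U →
      ∃ U M, cc U M = 1 ∧ 0 < x U ∧ 0 < (Y M).trace)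
    {A : Finset (OddSet n)} (hAt : ∀ U ∈ A, U.1.card = t) {lam : OddSet n → ℝ} (hpos : ∀ U ∈ A, 0 < lam U)
    (hlam : ∀ U ∈ A, (X U - lam U • (1 : Matrix (Fin r) (Fin r) ℝ)).PosSemidef) :
    ∑ U ∈ A, (X U).trace / r < ε * ((univ.filter fun U : OddSet n => U.1.card = t).card : ℝ) := by
  classical
  by_contra hge
  push Not at hge
  have hr' : (0 : ℝ) < r := by exact_mod_cast hr
  -- the weight `x = (tr X_U / r)·1_A`
  set x : OddSet n → ℝ := fun U => if U ∈ A then (X U).trace / r else 0 with hx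
  have hx01 : ∀ U, 0 ≤ x U ∧ x U ≤ 1 := by
    intro U
    by_cases hU : U ∈ A
    · simp only [hx, hU, if_true]
      refine ⟨div_nonneg (hXY.1 U).1.trace_nonneg hr'.le, ?_⟩
      rw [div_le_one hr']
      have h := (hXY.1 U).2.trace_nonneg
      rw [trace_sub, trace_one, Fintype.card_fin] at h
      linarith
    · simp only [hx, hU, if_false]; exact ⟨le_rfl, zero_le_one⟩
  have hxt : ∀ U, U.1.card ≠ t → x U = 0 := by
    intro U hU
    have : U ∉ A := fun h => hU (hAt U h)
    simp only [hx, this, if_false]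
  have hsum : ∑ U, x U = ∑ U ∈ A, (X U).trace / r := by
    rw [hx, ← sum_filter]; congr 1; ext U; simp
  obtain ⟨U, M, hcc, hxU, hyM⟩ := hSNT x hx01 hxt (by rw [hsum]; exact hge)
  have hUA : U ∈ A := by
    by_contra hU; simp only [hx, hU, if_false] at hxU; exact lt_irrefl _ hxU
  have := no_active_tight_pair_of_posDef hXY hpos hlam hUA hcc
  rw [this] at hyM
  exact lt_irrefl _ hyM

/-- Symmetrically, **full-rank matchings form a `y`-minority**: if the matchings `B` on which `Y_M` is positive definite carried weight meeting the
(SNT-q) threshold against the (dense) cut weight `tr X/r`, there would be an active tight pair `(U, M ∈ B)` — but `X_U = 0` for every `U` tight with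
`M ∈ B` (brick 58, transposed). Stated as: no `U` tight with some `M ∈ B` has `tr X_U > 0`. [cite: Rothvoss2017, §2 (PDF p. 6)] -/
theorem no_active_tight_pair_of_posDef_right {X : OddSet n → Matrix (Fin r) (Fin r) ℝ} {Y : PMatch n → Matrix (Fin r) (Fin r) ℝ}
    (hXY : IsPsdRect X Y) {B : Finset (PMatch n)} {kap : PMatch n → ℝ} (hpos : ∀ M ∈ B, 0 < kap M)
    (hkap : ∀ M ∈ B, (Y M - kap M • (1 : Matrix (Fin r) (Fin r) ℝ)).PosSemidef) {M : PMatch n} (hM : M ∈ B) {U : OddSet n}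
    (hcc : cc U M = 1) : X U = 0 := by
  have hXs : (X U)ᵀ = X U := by
    have h := (hXY.1 U).1.1; rwa [IsHermitian, conjTranspose_eq_transpose_of_trivial] at h
  have hYs : (Y M)ᵀ = Y M := by
    have h := (hXY.2.1 M).1.1; rwa [IsHermitian, conjTranspose_eq_transpose_of_trivial] at h
  have hYX : Y M * X U = 0 := by
    have h := congrArg transpose (hXY.2.2 U M hcc)
    rwa [transpose_mul, transpose_zero, hXs, hYs] at h
  have h1 : (kap M • (1 : Matrix (Fin r) (Fin r) ℝ)).PosDef := PosDef.one.smul (hpos M hM)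
  have hPD := h1.add_posSemidef (hkap M hM)
  rw [add_sub_cancel] at hPD
  have hdet : IsUnit (Y M).det := (isUnit_iff_isUnit_det (Y M)).1 hPD.isUnit
  have h := nonsing_inv_mul_cancel_left (Y M) (X U) hdet
  rw [hYX, Matrix.mul_zero] at h
  exact h.symm

end Summit.PneNP.PneNP.Theorems.ChebyshevTracialDesignSynchronisationTools
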